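import Summits.NavierStokesRegularity.FluidComputer.RowEncloseFrame
import HarnessLib

/-!
# Enclosure soundness III: the coefficient step on one sub-interval, and the accumulation
# (`pub-fluidc-bp3/R1-DESIGN.md` §9.2 / §9.4, layer B of `structure Row`)

HONEST FRAMING (cell `pub-fluidc`, blueprint seat bp3, gen 20): low prior, high value-of-information
experiment on Tao's machine paradigm; NOT a claim that NS blows up. Interval bookkeeping only.

The stage `sub a` of the row check evaluates, on the `a`-th of `KSUB` sub-intervals of `[0,H]`, the
frames `A(v)`, `G(v)`, the residual `R(v)`, the Jacobian `J(x̂(u))`, the projector `P̃(u)` and the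
products `AP̃`, `AP̃J`, `M = AP̃JG`, `K₀ = ȦG`, `ȦR`, `AP̃JR`, and from them the coefficient
interval `K = K₀ + ṡM` (`ṡ ∈ SD = [1−ρ, 1+ρ]`), the forcing coefficients
`CF = |ȦR| + (1+ρ)|AP̃JR|` and `|AP̃|`.
This file names those sub-stages (`sub_eq` by `rfl`), proves each encloses its real object for
`u` in the sub-interval (`mem_subK`, `CF_ge`, `APTM_ge`), and proves the accumulation lemma for
`subsAcc` (hull / max over `a < n`: `subsAcc_mono`) and that a passing accumulation passes every
sub-interval's sign test.

[cite: Tao2016AveragedNS, §5.5 Thm 5.3 (5.5)]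
-/

namespace Summit.NavierStokesRegularity.FluidComputer

open Literature.Analysis.FluidPDE.FluidComputer
open Literature.Analysis.ValidatedNumerics.Numerics (cdiv div_le_cdiv le_cdiv_mul_real)

namespace RowCheck

open DIVec ChainField Finset Real Set

namespace RowData

variable (r : RowData)

/-! ### Named sub-stages -/

/-- sub-interval `a` of `[0,H]`. [folklore] -/
def Ua (a : ℕ) : DI := subI r.P r.Hq r.KSUB a
/-- its left parameter `a/KSUB`. [folklore] -/
def va (a : ℕ) : DI := ofFrac r.P ((a : ℚ) / r.KSUB)
/-- its right parameter `(a+1)/KSUB`. [folklore] -/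
def vb (a : ℕ) : DI := ofFrac r.P (((a : ℚ) + 1) / r.KSUB)
/-- `A(v)` on the sub-interval. [folklore] -/
def Aa (a : ℕ) : Tab DI 9 9 := Tab.mk' fun i j =>
  ((r.A0I i j).add ((r.va a).mul r.P (r.pre.dA.at i j))).hull
    ((r.A0I i j).add ((r.vb a).mul r.P (r.pre.dA.at i j)))
/-- slot columns of `T̂(v)` on the sub-interval. [folklore] -/
def Ga (a : ℕ) : Tab DI 9 8 := Tab.mk' fun i j =>
  ((r.T0I i j.succ).add ((r.va a).mul r.P (r.pre.dT.at i j.succ))).hull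
    ((r.T0I i j.succ).add ((r.vb a).mul r.P (r.pre.dT.at i j.succ)))
/-- `v` on the sub-interval. [folklore] -/
def Va (a : ℕ) : DI := (r.va a).hull (r.vb a)
/-- `1 − v`. [folklore] -/
def OmV (a : ℕ) : DI := (⟨one r.P, one r.P⟩ : DI).sub (r.Va a)
/-- `v(1−v)`. [folklore] -/
def VV (a : ℕ) : DI := (r.Va a).mul r.P (r.OmV a)
/-- `R(v)` on the sub-interval. [folklore] -/
def Ra (a : ℕ) : Tab DI 9 9 := Tab.mk' fun i j =>
  (((r.OmV a).mul r.P ((eyeI r.P i j).sub (r.pre.TA0.at i j))).add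
    ((r.Va a).mul r.P ((eyeI r.P i j).sub (r.pre.TA1.at i j)))).add
      ((r.VV a).mul r.P (r.pre.dTdA.at i j))
/-- `J(x̂)` on the sub-interval. [folklore] -/
def JIa (a : ℕ) : Tab DI 9 9 := Tab.mk' (JmatI r.P r.cU r.cD (r.XIon (r.Ua a)).get)
/-- `P̃` on the sub-interval. [folklore] -/
def PTa (a : ℕ) : Tab DI 9 9 := r.PT (r.DXIon (r.Ua a)) (r.sInv ((r.DXIon (r.Ua a)).get r.p))
/-- `ṡ ∈ [1−ρ, 1+ρ]`. [folklore] -/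
def SD : DI := ⟨one r.P - r.ph'.rho, one r.P + r.ph'.rho⟩
/-- `AP̃`. [folklore] -/
def APta (a : ℕ) : Tab DI 9 9 := mulT r.P (r.Aa a) (r.PTa a)
/-- `AP̃J`. [folklore] -/
def APJa (a : ℕ) : Tab DI 9 9 := mulT r.P (r.APta a) (r.JIa a)
/-- `M = AP̃JG`. [folklore] -/
def Maa (a : ℕ) : Tab DI 9 8 := mulT r.P (r.APJa a) (r.Ga a)
/-- `K₀ = ȦG`. [folklore] -/
def K0a (a : ℕ) : Tab DI 9 8 := mulT r.P r.pre.AD (r.Ga a)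
/-- `ȦR`. [folklore] -/
def ADRa (a : ℕ) : Tab DI 9 9 := mulT r.P r.pre.AD (r.Ra a)
/-- `AP̃JR`. [folklore] -/
def APJRa (a : ℕ) : Tab DI 9 9 := mulT r.P (r.APJa a) (r.Ra a)

/-- The stage `sub` in terms of the named sub-stages. [folklore] -/
theorem sub_eq (a : ℕ) : r.sub r.pre r.ph'.rho a =
    ⟨Tab.mk' fun i j => ((r.K0a a).at i.succ j).add (r.SD.mul r.P ((r.Maa a).at i.succ j)),
     Tab.mk' fun i k =>
       ((r.ADRa a).at i k).mag + cdiv ((one r.P + r.ph'.rho) * ((r.APJRa a).at i k).mag) (one r.P),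
     Tab.mk' fun i k => ((r.APta a).at i k).mag, signDef ((r.DXIon (r.Ua a)).get r.p)⟩ := rfl

/-! ### The real objects on a sub-interval -/

/-- `Ȧ = ΔA/H` as a real matrix. [folklore] -/
noncomputable def Frames.ADm {r : RowData} (Fr : r.Frames) : Matrix (Fin 9) (Fin 9) ℝ :=
  fun i j => Fr.dA i j / r.Hq
/-- slot columns of `T̂(v)`. [folklore] -/
def Frames.Gv {r : RowData} (Fr : r.Frames) (v : ℝ) : Matrix (Fin 9) (Fin 8) ℝ :=
  fun b j => Fr.Tv v b j.succ
/-- `P̃(u)` with `x̂'` the derivative of the reference centre. [folklore] -/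
noncomputable def Ptm (u : ℝ) : Matrix (Fin 9) (Fin 9) ℝ := fun a b =>
  (if a = b then (1 : ℝ) else 0) - xhd r.CQ u a * (if b = r.p then (xhd r.CQ u r.p)⁻¹ else 0)

variable {r} (Fr : r.Frames) {g : GateData} {Λ : ℝ}

/-- The sub-interval parameters. [folklore] -/
theorem mem_va (a : ℕ) : (r.va a).mem r.P ((a : ℝ) / r.KSUB) := by
  have := mem_ofFrac r.P ((a : ℚ) / r.KSUB); unfold va; push_cast at this; exact this

/-- The sub-interval parameters. [folklore] -/
theorem mem_vb (a : ℕ) : (r.vb a).mem r.P (((a : ℝ) + 1) / r.KSUB) := by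
  have := mem_ofFrac r.P (((a : ℚ) + 1) / r.KSUB); unfold vb; push_cast at this; exact this

/-- `v ∈ Va`. [folklore] -/
theorem mem_Va {a : ℕ} {v : ℝ} (h0 : (a : ℝ) / r.KSUB ≤ v) (h1 : v ≤ ((a : ℝ) + 1) / r.KSUB) :
    (r.Va a).mem r.P v :=
  DI.mem_hull_of_between (mem_va a) (mem_vb a) h0 h1

/-- `1 − v ∈ OmV`. [folklore] -/
theorem mem_OmV {a : ℕ} {v : ℝ} (h0 : (a : ℝ) / r.KSUB ≤ v) (h1 : v ≤ ((a : ℝ) + 1) / r.KSUB) :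
    (r.OmV a).mem r.P (1 - v) := by
  refine DI.mem_sub ?_ (mem_Va h0 h1)
  have := DI.mem_pt r.P (one r.P)
  simp only [one, Int.cast_pow, Int.cast_ofNat] at this
  rw [div_self (by positivity)] at this
  exact this

/-- `v(1−v) ∈ VV`. [folklore] -/
theorem mem_VV {a : ℕ} {v : ℝ} (h0 : (a : ℝ) / r.KSUB ≤ v) (h1 : v ≤ ((a : ℝ) + 1) / r.KSUB) :
    (r.VV a).mem r.P (v * (1 - v)) :=
  DI.mem_mul (mem_Va h0 h1) (mem_OmV h0 h1)

/-- `A(v) ∈ Aa`. [folklore] -/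
theorem mem_Aa {a : ℕ} {v : ℝ} (h0 : (a : ℝ) / r.KSUB ≤ v) (h1 : v ≤ ((a : ℝ) + 1) / r.KSUB)
    (i j : Fin 9) : ((r.Aa a).at i j).mem r.P (Fr.Av v i j) := by
  rw [Aa, Tab.at_mk']
  exact Fr.mem_Aseg (mem_va a) (mem_vb a) h0 h1 i j

/-- `G(v) ∈ Ga`. [folklore] -/
theorem mem_Ga {a : ℕ} {v : ℝ} (h0 : (a : ℝ) / r.KSUB ≤ v) (h1 : v ≤ ((a : ℝ) + 1) / r.KSUB)
    (i : Fin 9) (j : Fin 8) : ((r.Ga a).at i j).mem r.P (Fr.Gv v i j) := by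
  rw [Ga, Tab.at_mk']
  exact Fr.mem_Tseg (mem_va a) (mem_vb a) h0 h1 i j

/-- `R(v) ∈ Ra`. [folklore] -/
theorem mem_Ra {a : ℕ} {v : ℝ} (h0 : (a : ℝ) / r.KSUB ≤ v) (h1 : v ≤ ((a : ℝ) + 1) / r.KSUB)
    (i j : Fin 9) : ((r.Ra a).at i j).mem r.P (Fr.Rv v i j) := by
  rw [Ra, Tab.at_mk']
  exact Fr.mem_Rseg (mem_Va h0 h1) (mem_OmV h0 h1) (mem_VV h0 h1) i j

/-- `J(x̂(u)) ∈ JIa`. [folklore] -/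
theorem mem_JIa (hU : r.cU.Mem r.P g) (hD : r.cD.Mem r.P (scaled g Λ)) {a : ℕ} {u : ℝ}
    (hu : (r.Ua a).mem r.P u) (i l : Fin 9) :
    ((r.JIa a).at i l).mem r.P (Jmat g Λ (xh r.CQ u) i l) :=
  r.mem_JI hU hD hu i l

/-- `P̃(u) ∈ PTa`. [folklore] -/
theorem mem_PTa {a : ℕ} (hok : signDef ((r.DXIon (r.Ua a)).get r.p) = true)
    (hlen : ∀ i, (r.CQ i).length ≤ r.DEG + 1) {u : ℝ} (hu : (r.Ua a).mem r.P u) (i b : Fin 9) :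
    ((r.PTa a).at i b).mem r.P (r.Ptm u i b) :=
  r.mem_PT (fun c => r.mem_DXIon hu (hlen c)) hok i b

/-- `ṡ ∈ SD` when `|ṡ − 1| ≤ ρ`. [folklore] -/
theorem mem_SD {s : ℝ} (hs : |s - 1| ≤ (r.ph'.rho : ℝ) / 2 ^ r.P) : r.SD.mem r.P s := by
  have hO : (0 : ℝ) < 2 ^ r.P := by positivity
  obtain ⟨h1, h2⟩ := abs_le.mp hs
  have e : (r.ph'.rho : ℝ) / 2 ^ r.P * 2 ^ r.P = r.ph'.rho := div_mul_cancel₀ _ hO.ne'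
  have h1' : -(r.ph'.rho : ℝ) ≤ (s - 1) * 2 ^ r.P := by
    have := mul_le_mul_of_nonneg_right h1 hO.le; rwa [neg_mul, e] at this
  have h2' : (s - 1) * 2 ^ r.P ≤ r.ph'.rho := by
    have := mul_le_mul_of_nonneg_right h2 hO.le; rwa [e] at this
  refine ⟨?_, ?_⟩
  · simp only [SD, one, Int.cast_sub, Int.cast_pow, Int.cast_ofNat]; nlinarith
  · simp only [SD, one, Int.cast_add, Int.cast_pow, Int.cast_ofNat]; nlinarith

/-- `Ȧ ∈ pre.AD` as a matrix statement. [folklore] -/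
theorem mem_ADm (hH : 0 < (ofFrac r.P r.Hq).lo) (i j : Fin 9) :
    (r.pre.AD.at i j).mem r.P (Fr.ADm i j) :=
  Fr.mem_AD hH i j

section products

variable (hU : r.cU.Mem r.P g) (hD : r.cD.Mem r.P (scaled g Λ)) (hH : 0 < (ofFrac r.P r.Hq).lo)
  (hlen : ∀ i, (r.CQ i).length ≤ r.DEG + 1) {a : ℕ}
  (hok : signDef ((r.DXIon (r.Ua a)).get r.p) = true) {u v : ℝ} (hu : (r.Ua a).mem r.P u)
  (h0 : (a : ℝ) / r.KSUB ≤ v) (h1 : v ≤ ((a : ℝ) + 1) / r.KSUB)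
include hlen hok hu h0 h1

/-- `AP̃ ∈ APta`. [folklore] -/
theorem mem_APta (i k : Fin 9) : ((r.APta a).at i k).mem r.P ((Fr.Av v * r.Ptm u) i k) :=
  mem_mulT r.P (mem_Aa Fr h0 h1) (mem_PTa hok hlen hu) i k

include hU hD

/-- `AP̃J ∈ APJa`. [folklore] -/
theorem mem_APJa (i k : Fin 9) :
    ((r.APJa a).at i k).mem r.P ((Fr.Av v * r.Ptm u * Jmat g Λ (xh r.CQ u)) i k) :=
  mem_mulT r.P (mem_APta Fr hlen hok hu h0 h1) (mem_JIa hU hD hu) i k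

/-- `M = AP̃JG ∈ Maa`. [folklore] -/
theorem mem_Maa (i : Fin 9) (j : Fin 8) :
    ((r.Maa a).at i j).mem r.P ((Fr.Av v * r.Ptm u * Jmat g Λ (xh r.CQ u) * Fr.Gv v) i j) :=
  mem_mulT r.P (mem_APJa Fr hU hD hlen hok hu h0 h1) (mem_Ga Fr h0 h1) i j

/-- `AP̃JR ∈ APJRa`. [folklore] -/
theorem mem_APJRa (i k : Fin 9) :
    ((r.APJRa a).at i k).mem r.P ((Fr.Av v * r.Ptm u * Jmat g Λ (xh r.CQ u) * Fr.Rv v) i k) :=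
  mem_mulT r.P (mem_APJa Fr hU hD hlen hok hu h0 h1) (mem_Ra Fr h0 h1) i k

omit hU hD hlen hok hu
include hH

/-- `K₀ = ȦG ∈ K0a`. [folklore] -/
theorem mem_K0a (i : Fin 9) (j : Fin 8) :
    ((r.K0a a).at i j).mem r.P ((Fr.ADm * Fr.Gv v) i j) :=
  mem_mulT r.P (mem_ADm Fr hH) (mem_Ga Fr h0 h1) i j

/-- `ȦR ∈ ADRa`. [folklore] -/
theorem mem_ADRa (i k : Fin 9) : ((r.ADRa a).at i k).mem r.P ((Fr.ADm * Fr.Rv v) i k) :=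
  mem_mulT r.P (mem_ADm Fr hH) (mem_Ra Fr h0 h1) i k

include hU hD hlen hok hu

/-- The coefficient interval of the sub-interval encloses `K₀ + ṡM` (slot rows). [folklore] -/
theorem mem_subK {s : ℝ} (hs : |s - 1| ≤ (r.ph'.rho : ℝ) / 2 ^ r.P) (i j : Fin 8) :
    ((r.sub r.pre r.ph'.rho a).K.at i j).mem r.P
      ((Fr.ADm * Fr.Gv v) i.succ j +
        s * (Fr.Av v * r.Ptm u * Jmat g Λ (xh r.CQ u) * Fr.Gv v) i.succ j) := by
  rw [sub_eq, Tab.at_mk']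
  exact DI.mem_add (mem_K0a Fr hH h0 h1 _ _)
    (DI.mem_mul (mem_SD hs) (mem_Maa Fr hU hD hlen hok hu h0 h1 _ _))

/-- The forcing coefficients of the sub-interval bound `|ȦR| + (1+ρ)|AP̃JR|`. [folklore] -/
theorem CF_ge (hρ : 0 ≤ r.ph'.rho) (i k : Fin 9) :
    |(Fr.ADm * Fr.Rv v) i k| +
        (1 + (r.ph'.rho : ℝ) / 2 ^ r.P) *
          |(Fr.Av v * r.Ptm u * Jmat g Λ (xh r.CQ u) * Fr.Rv v) i k| ≤
      (((r.sub r.pre r.ph'.rho a).CF.at i k : ℤ) : ℝ) / 2 ^ r.P := by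
  have hO : (0 : ℝ) < 2 ^ r.P := by positivity
  rw [sub_eq, Tab.at_mk', Int.cast_add, add_div]
  refine add_le_add (DI.abs_le_mag (mem_ADRa Fr hH h0 h1 i k)) ?_
  have hm := DI.abs_le_mag (mem_APJRa Fr hU hD hlen hok hu h0 h1 i k)
  have hc := div_le_cdiv_one r.P ((one r.P + r.ph'.rho) * ((r.APJRa a).at i k).mag)
  have h1' : (1 + (r.ph'.rho : ℝ) / 2 ^ r.P) = ((one r.P + r.ph'.rho : ℤ) : ℝ) / 2 ^ r.P := by
    simp only [one, Int.cast_add, Int.cast_pow, Int.cast_ofNat]; field_simp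
  have hnn : (0 : ℝ) ≤ 1 + (r.ph'.rho : ℝ) / 2 ^ r.P := by positivity
  calc (1 + (r.ph'.rho : ℝ) / 2 ^ r.P) * |(Fr.Av v * r.Ptm u * Jmat g Λ (xh r.CQ u) * Fr.Rv v) i k|
      ≤ (1 + (r.ph'.rho : ℝ) / 2 ^ r.P) * ((((r.APJRa a).at i k).mag : ℝ) / 2 ^ r.P) :=
        mul_le_mul_of_nonneg_left hm hnn
    _ = (((one r.P + r.ph'.rho : ℤ) : ℝ) * ((r.APJRa a).at i k).mag / 2 ^ r.P) / 2 ^ r.P := by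
        rw [h1']; ring
    _ ≤ _ := by
        refine div_le_div_of_nonneg_right ?_ hO.le
        push_cast at hc ⊢
        exact hc

omit hU hD hH in
/-- `|AP̃|` of the sub-interval bounds the real `AP̃`. [folklore] -/
theorem APTM_ge (i k : Fin 9) :
    |(Fr.Av v * r.Ptm u) i k| ≤ (((r.sub r.pre r.ph'.rho a).APTM.at i k : ℤ) : ℝ) / 2 ^ r.P := by
  rw [sub_eq, Tab.at_mk']
  exact DI.abs_le_mag (mem_APta Fr hlen hok hu h0 h1 i k)

end products

/-! ### The accumulation over sub-intervals -/

/-- [folklore] -/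
theorem subsAcc_one (q : Pre) (rho : ℤ) : r.subsAcc q rho 1 = r.sub q rho 0 := by
  simp [subsAcc]

/-- [folklore] -/
theorem subsAcc_succ (q : Pre) (rho : ℤ) {n : ℕ} (hn : n ≠ 0) : r.subsAcc q rho (n + 1) =
    ⟨Tab.mk' fun i j => ((r.subsAcc q rho n).K.at i j).hull ((r.sub q rho n).K.at i j),
     Tab.mk' fun i k => max ((r.subsAcc q rho n).CF.at i k) ((r.sub q rho n).CF.at i k),
     Tab.mk' fun i k => max ((r.subsAcc q rho n).APTM.at i k) ((r.sub q rho n).APTM.at i k),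
     (r.subsAcc q rho n).ok && (r.sub q rho n).ok⟩ := by
  rw [subsAcc, if_neg hn]

/-- Accumulation: every sub-interval `a < n` is dominated by `subsAcc n` (hull of `K`, max of `CF`,
`APTM`, conjunction of `ok`). [folklore] -/
theorem subsAcc_mono (q : Pre) (rho : ℤ) : ∀ (n a : ℕ), a < n →
    (∀ i j x, ((r.sub q rho a).K.at i j).mem r.P x → ((r.subsAcc q rho n).K.at i j).mem r.P x) ∧
    (∀ i k, (r.sub q rho a).CF.at i k ≤ (r.subsAcc q rho n).CF.at i k) ∧
    (∀ i k, (r.sub q rho a).APTM.at i k ≤ (r.subsAcc q rho n).APTM.at i k) ∧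
    ((r.subsAcc q rho n).ok = true → (r.sub q rho a).ok = true)
  | 0, a, h => absurd h (Nat.not_lt_zero a)
  | n + 1, a, h => by
    by_cases hn : n = 0
    · subst hn
      have ha : a = 0 := by omega
      subst ha
      rw [subsAcc_one]
      exact ⟨fun _ _ _ hx => hx, fun _ _ => le_rfl, fun _ _ => le_rfl, id⟩
    · rw [subsAcc_succ q rho hn]
      simp only [Tab.at_mk', Bool.and_eq_true]
      rcases Nat.lt_succ_iff_lt_or_eq.mp h with hlt | rfl
      · obtain ⟨hK, hC, hA, hok⟩ := subsAcc_mono q rho n a hlt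
        exact ⟨fun i j x hx => DI.mem_hull_left (hK i j x hx),
          fun i k => (hC i k).trans (le_max_left _ _), fun i k => (hA i k).trans (le_max_left _ _),
          fun h' => hok h'.1⟩
      · exact ⟨fun i j x hx => DI.mem_hull_right hx, fun i k => le_max_right _ _,
          fun i k => le_max_right _ _, fun h' => h'.2⟩

/-- The stage `sb'` is the accumulation over all `KSUB` sub-intervals. [folklore] -/
theorem sb'_eq : r.sb' = r.subsAcc r.pre r.ph'.rho r.KSUB := rfl

end RowData

end RowCheck

end Summit.NavierStokesRegularity.FluidComputer
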